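import Summits.QuantumFields.YangMills.Theorems.UnitScaleTiltProp7StoreyHGradientRowAllMembers
import Summits.QuantumFields.YangMills.Theorems.UnitScaleTiltProp7AxialHolderBridge
import HarnessLib

/-!
# Route `UnitScaleTilt`, crux K1 «MinimiserStabilityRegPr» (stmt-QuantumFields-19200), EX row (5) `h3` (STOREY H), H-ROAD brick **H8-R′ (v2) = H8-R WITH ITS HÖLDER LETTER WINDOWED TO
# `tdist ≤ ℓ`** (★CHAIR WORD №53 ∕ ★★OWNER RECORD 17df «local pipeline (i)–(iv)»; ★★OWNER g36 ■ FINAL NOTICE (1): pen px17 g13; supersedes this seat's HELD v1 eecf0d2f, which displayed the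
# now-retired GLOBAL small-field clause): the 𝔊-door's third-word gradient letter `h3` at EVERY member from the four value letters, H7-R's absorption margin, and ONE Hölder display —
# H8-R's cover-axial ½-Hölder letter of `ω₁(A)` (the transported field `σ̃_ct·ω₁(A)♭∘π·σ̃_ct*` on the cover balls `tdist (ẽ ct) · ≤ 4ℓ+1`) asked ONLY FOR PAIRS AT DISTANCE `≤ ℓ = L^(K−n)`
# (px13 g17's BRIDGE v2 display `hax`, [Balaban1985BackgroundPropagators] p.399 L1–3: Thm 3.1's modulus is a WINDOWED statement) — exactly the letter pipeline (ii) (H2 in the cover's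
# axial gauge at the centre, small field on the `12ℓ+4` ball by pipeline (i) ✓∕⧗`Prop7LocalAxialGaugeSmallField`) delivers; the window is removed INSIDE by BRIDGE v2
# ✓∕⧗`Prop7AxialHolderBridge.hHωt_of_window` with the sup `N_ω` of H1 (✓`Prop7StoreyHValueRows.storeyH_value_rows`, first conjunct — internal, linear in `‖A‖`).  NO gauge letter, NO `hsf`,
# NO room.

Cell `ym3-torus` (HUMAN RULING D-0037; rung R3 = SU(2) YM₃ on T³ — NOT d = 4, NOT infinite volume, NOT a mass gap, NOT Clay).  Width seat `ym3-torus-px17` (gen 13; lineage recipe of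
px17 g12 ■ FINAL 15:51:20Z, re-aimed per №53); `--supports stmt-QuantumFields-19200 --as helper`; count-neutral; THEOREMS ONLY (0 `def`, 0 `sorry`, default heartbeats).

WHAT IS PROVED (ns `Summit.QuantumFields.YangMills.Theorems.Prop7StoreyHGradientRowOfWindowedHolder`).
* ★★★ `h3_of_windowedHolderLetter_allMembers` — under `RegPr F n K ε₀ U₀` (`0 < ε₀ ≤ 1`), `0 ≤ a`, ANY Hessian slot `Δx`, the value letters (Div1) `hD1`, `hR`, (c1) `hc1`, (c2) `hc2`
  (H1+H3's texts VERBATIM), the WINDOWED cover-axial Hölder letter `hHωw` (= H8-R's `hHωt` binder text with the one extra antecedent `tdist yt yt' ≤ L^(K−n)`, at `ω := ω₁(A)`,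
  `Hω := C_{Hω}·‖A‖`) and H7-R's margin `hsmall`: `∀ A, ‖∇^η_{(115)}(toL2⁻¹(D_{U₀}(G′ᴾ_a(ω₁(A)))) ∘ bondEquiv⁻¹)‖ ≤ M₃′·‖A‖` — the 𝔊-door's `h3` binder text (slot-generic `Δx`),
  `M₃′ = M₃[C_{Hω} ↦ C_{Hω} + 2·(C_R√2B_{D1})]` closed (window removal costs `2N_ω`, `N_ω = (C_R√2B_{D1})‖A‖`).
HYP-SAT (★★OWNER RULING №42).  As H8-R: `RegPr`-class + real sup letters between displayed terms (inhabited by the landed L-only families); the windowed Hölder letter is print's Thm 3.1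
(3.42) modulus class for the source `D*_{U₀}G_{Δx}(toL2 A)` in a LOCAL axial gauge (no global gauge representative is asked for — RECORD 17df); at `A = 0` every letter and the conclusion read
`0 ≤ 0` — non-vacuous, no `Prop` placeholder.  HONEST SCOPE: a one-step assembly (H8-R ∘ BRIDGE v2 §0 ∘ H1); the windowed Hölder letter is DISPLAYED, not proved (pipeline (ii)); nothing
of `norm_G`, the EX display, EX `stub_existenceMinimalOrbit`, `MinimiserStabilityRegPr` (19200) or R3 is proved; rung R3 = SU(2) YM₃ on T³ — NOT d = 4, NOT infinite volume, NOT a mass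
gap, NOT Clay.  px17 g13 (prover-ym3-torus-px17-g13-0), generator `gen/gen_h8Rprime_v2.py` over H8-R's statement text.  Def-free; no `sorry`; default heartbeats.

References: T. Bałaban, CMP **99** (1985) 389–434 [Balaban1985BackgroundPropagators] (Thm 3.1 (3.42)–(3.44) pp.397–398, (3.35) p.396, p.399 L1–3, (3.117)–(3.122) pp.419–420,
Thm 3.13 p.426); CMP **102** (1985) 277–309 [Balaban1985Variational] ((19) p.281, (115)–(117) pp.294–295); CMP **96** (1984) 223–250 [Balaban1984PropagatorsII] ((1.40) p.230).
-/

set_option autoImplicit false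

noncomputable section

open scoped BigOperators Matrix.Norms.L2Operator InnerProductSpace ComplexConjugate

namespace Summit.QuantumFields.YangMills.Theorems.Prop7StoreyHGradientRowOfWindowedHolder

open Literature.MathematicalPhysics.QuantumFieldTheory.Balaban1983to89
open Literature.MathematicalPhysics.QuantumFieldTheory.Balaban1983to89.T3ContinuumYM3Torus
open T3PrintedRegularMinimiser (RegPr)
open T3SectALandauChart (eta eta_pos covGradT bgUnits)
open B10Eq27TorusAxialLog (axialT)
open B4Sect5Torus (TSite tdist)
open B9SectCLatticeCarrier (Bond)
open B9Eq311L2Pairing (WL2)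
open B11Eq111FrakG (nabla115)
open B11Eq103H1Complex (SiteL2K BondL2K)
open Summit.QuantumFields.YangMills.Theorems.Prop7SectET3Transport (periodsT3 siteEquiv bondEquiv bgOfCfg)
open Summit.QuantumFields.YangMills.Theorems.Prop7SectET3HilbertLetters (W₂ toL2 toL2S DL2 DstarL2 covLapSite)
open Summit.QuantumFields.YangMills.Theorems.Prop7SectET3GaugeProjector (RS)
open Summit.QuantumFields.YangMills.Theorems.Prop7SectET3CurvedPropagators (GT)
open Summit.QuantumFields.YangMills.Theorems.Prop7SectET3DeltaPiPInv (GprimeP)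
open Summit.QuantumFields.YangMills.Theorems.Prop7CurvedMemberLocalHessian (exists_curved_localHessian)
open Summit.QuantumFields.YangMills.Theorems.AxialGaugeChartGlue (norm_bgOfCfg_axialT_sub_le)
open Summit.QuantumFields.YangMills.Theorems.Prop7StoreyHGradientRowAllMembers (h3_of_holderLetters_allMembers)
open Summit.QuantumFields.YangMills.Theorems.Prop7AxialHolderBridge (hHωt_of_window)
open Summit.QuantumFields.YangMills.Theorems.CoverSites
open Summit.QuantumFields.YangMills.Theorems.Prop7StoreyHValueRows (storeyH_value_rows)

variable (F : T3Family) {n K : ℕ} (h : n ≤ K) (c₀ cB : ℝ) [Fact (0 < c₀)] [Fact (0 < cB)]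
  {a : ℝ} (Δx : GaugeField (F.P K) 0 (Matrix.specialUnitaryGroup (Fin 2) ℂ) → (BondL2K ℂ 3 (periodsT3 F K) c₀ W₂ →ₗ[ℂ] BondL2K ℂ 3 (periodsT3 F K) c₀ W₂))
  {ε₀ : ℝ} (hε₀ : 0 < ε₀) (hε1 : ε₀ ≤ 1)
  (U₀ : GaugeField (F.P K) 0 (Matrix.specialUnitaryGroup (Fin 2) ℂ)) (hreg : RegPr F n K ε₀ U₀)

/-! ## ★★★ H8-R′ v2: the `h3` letter at every member with the Hölder input WINDOWED -/

include hε₀ hε1 hreg in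
/-- ★★★ **H8-R′ v2 — STOREY H's `h3` AT EVERY MEMBER, HÖLDER INPUT WINDOWED TO `tdist ≤ ℓ`.**  At a printed-regular background (`RegPr F n K ε₀ U₀`, `0 < ε₀ ≤ 1`), coupling `0 ≤ a`, ANY
Hessian slot `Δx`: the value letters (Div1) `hD1`, `hR`, (c1) `hc1`, (c2) `hc2` (H1+H3's texts VERBATIM), the WINDOWED cover-axial ½-Hölder letter `hHωw` of
`ω₁(A) := R_S(D*_{U₀}(G_{Δx}(toL2 A)))` (H8-R's `hHωt` text + `tdist yt yt' ≤ L^(K−n) →`, `Hω := C_{Hω}·‖A‖`), and H7-R's absorption margin `hsmall` give the 𝔊-door's `h3` binder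
text `∀ A, ‖∇^η_{(115)}(toL2⁻¹(D_{U₀}(G′ᴾ_a(ω₁(A)))) ∘ bondEquiv⁻¹)‖ ≤ M₃′·‖A‖`, `M₃′ = M₃[C_{Hω} ↦ C_{Hω} + 2(C_R√2B_{D1})]` closed.
PROOF: H8-R ✓`h3_of_holderLetters_allMembers` at `C_{Hω} ↦ C_{Hω} + 2(C_R√2B_{D1})`, its cover letter `hHωt` supplied per `A` by BRIDGE v2 ✓`hHωt_of_window` from `hHωw A` and the
internal sup row `N_ω` (✓`storeyH_value_rows`, conj. 1); the constant is linear in `‖A‖` (`ring`).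
[cite: Balaban1985BackgroundPropagators, Thm 3.1 (3.42)–(3.44) pp.397–398, p.399 L1–3, (3.117)–(3.122) pp.419–420; Balaban1985Variational, (19) p.281, (115)–(117) pp.294–295; Balaban1984PropagatorsII, (1.40) p.230] -/
theorem h3_of_windowedHolderLetter_allMembers (ha : 0 ≤ a) {BD₁ CR C₁ C₂ CHω : ℝ} (hBD₁ : 0 ≤ BD₁) (hCR : 0 ≤ CR) (hC₁ : 0 ≤ C₁) (hC₂ : 0 ≤ C₂) (hCHω : 0 ≤ CHω)
    (hD1 : ∀ (A : PBond (F.P K) 0 → Matrix (Fin 2) (Fin 2) ℂ) (x : Site (F.P K) 0),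
      ‖(toL2S F K c₀).symm (DstarL2 F n K c₀ U₀ (GT F n K h c₀ cB a Δx U₀ (toL2 F K c₀ A))) x‖ ≤ BD₁ * ‖A‖)
    (hR : ∀ (g : SiteL2K ℂ 3 (periodsT3 F K) c₀ W₂) (Gb : ℝ), (∀ y, ‖WL2.equiv ℂ _ W₂ g y‖ ≤ Gb) → ∀ y, ‖WL2.equiv ℂ _ W₂ (RS F n K h c₀ cB U₀ g) y‖ ≤ CR * Gb)
    (hc1 : ∀ (v : Site (F.P K) 0 → Matrix (Fin 2) (Fin 2) ℂ) (m : ℝ), (∀ x, ‖v x‖ ≤ m) →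
      ∀ x, ‖(toL2S F K c₀).symm (GprimeP F n K h c₀ cB a U₀ (RS F n K h c₀ cB U₀ (toL2S F K c₀ v))) x‖ ≤ C₁ * m)
    (hc2 : ∀ (v : Site (F.P K) 0 → Matrix (Fin 2) (Fin 2) ℂ) (m : ℝ), (∀ x, ‖v x‖ ≤ m) →
      ∀ b, ‖(toL2 F K c₀).symm (DL2 F n K c₀ U₀ (GprimeP F n K h c₀ cB a U₀ (RS F n K h c₀ cB U₀ (toL2S F K c₀ v)))) b‖ ≤ C₂ * m)
    (hHωw : ∀ (A : PBond (F.P K) 0 → Matrix (Fin 2) (Fin 2) ℂ) (ct : Site ((F.cover 3).P K) 0) (yt yt' : TSite 3 (periodsT3 (F.cover 3) K)),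
      tdist (periodsT3 (F.cover 3) K) (siteEquiv (F.cover 3) K ct) yt ≤ 4 * (F.L : ℝ) ^ (K - n) + 1 →
      tdist (periodsT3 (F.cover 3) K) (siteEquiv (F.cover 3) K ct) yt' ≤ 4 * (F.L : ℝ) ^ (K - n) + 1 →
      tdist (periodsT3 (F.cover 3) K) yt yt' ≤ (F.L : ℝ) ^ (K - n) →
      ‖WL2.equiv ℂ (fun _ : TSite 3 (periodsT3 (F.cover 3) K) => c₀) W₂
            (toL2S (F.cover 3) K c₀ (fun zt => ((axialT (U₀ ∘ projBond (F.P K) 3 0) ct zt : Matrix.specialUnitaryGroup (Fin 2) ℂ) : Matrix (Fin 2) (Fin 2) ℂ)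
              * (toL2S F K c₀).symm (RS F n K h c₀ cB U₀ (DstarL2 F n K c₀ U₀ (GT F n K h c₀ cB a Δx U₀ (toL2 F K c₀ A)))) (proj (F.P K) 3 0 zt)
              * star ((axialT (U₀ ∘ projBond (F.P K) 3 0) ct zt : Matrix.specialUnitaryGroup (Fin 2) ℂ) : Matrix (Fin 2) (Fin 2) ℂ))) yt'
          - WL2.equiv ℂ (fun _ : TSite 3 (periodsT3 (F.cover 3) K) => c₀) W₂
            (toL2S (F.cover 3) K c₀ (fun zt => ((axialT (U₀ ∘ projBond (F.P K) 3 0) ct zt : Matrix.specialUnitaryGroup (Fin 2) ℂ) : Matrix (Fin 2) (Fin 2) ℂ)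
              * (toL2S F K c₀).symm (RS F n K h c₀ cB U₀ (DstarL2 F n K c₀ U₀ (GT F n K h c₀ cB a Δx U₀ (toL2 F K c₀ A)))) (proj (F.P K) 3 0 zt)
              * star ((axialT (U₀ ∘ projBond (F.P K) 3 0) ct zt : Matrix.specialUnitaryGroup (Fin 2) ℂ) : Matrix (Fin 2) (Fin 2) ℂ))) yt‖
        ≤ (CHω * ‖A‖) * (tdist (periodsT3 (F.cover 3) K) yt yt' / ((F.L : ℝ) ^ (K - n))) ^ ((1 : ℝ) / 2))
    (hsmall : exists_curved_localHessian.choose * ((48 * ε₀) * (6 * Real.sqrt 2 * Real.sqrt 10 + 6 * Real.sqrt 2)) ≤ 1 / 2) :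
    ∀ A : PBond (F.P K) 0 → Matrix (Fin 2) (Fin 2) ℂ,
      ‖nabla115 (((F.L : ℝ)⁻¹) ^ (K - n)) (bgOfCfg F K U₀)
          (fun q : Bond 3 (periodsT3 F K) => (toL2 F K c₀).symm (DL2 F n K c₀ U₀ (GprimeP F n K h c₀ cB a U₀ (RS F n K h c₀ cB U₀
            (DstarL2 F n K c₀ U₀ (GT F n K h c₀ cB a Δx U₀ (toL2 F K c₀ A)))))) ((bondEquiv F K).symm q))‖
        ≤ (2 * (exists_curved_localHessian.choose *
            ((Real.sqrt 2 * (C₂ * BD₁)) + ((2 * Real.sqrt 2 * (4 * ε₀ * (3 + 2457 * norm_bgOfCfg_axialT_sub_le.choose)) * (CR * (Real.sqrt 2 * BD₁)) + (CHω + 2 * (CR * (Real.sqrt 2 * BD₁))))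
              + 2 * Real.sqrt 2 * ((4 * ε₀ * (3 + 2457 * norm_bgOfCfg_axialT_sub_le.choose)) * (Real.sqrt 2 * (C₂ * BD₁)) + (48 * ε₀) * (3 * Real.sqrt 10 * (2 * Real.sqrt 2 * (48 * ε₀) * (Real.sqrt 2 * (C₂ * BD₁))))))
            + (6 * Real.sqrt 2 * (48 * ε₀) * ((CR * (Real.sqrt 2 * BD₁)) + 2 * Real.sqrt 2 * (48 * ε₀) * (Real.sqrt 2 * (C₂ * BD₁)) + 2 * Real.sqrt 2 * (48 * ε₀) * (Real.sqrt 2 * (C₂ * BD₁))) + (Real.sqrt 2 * (C₂ * BD₁))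
              + Real.sqrt 2 * ((2 * ε₀ + 24 * ε₀ ^ 2) * (Real.sqrt 2 * (C₁ * BD₁)) + 12 * ε₀ * (Real.sqrt 2 * (C₂ * BD₁)))))
          + 2 * Real.sqrt 2 * (48 * ε₀) * (Real.sqrt 2 * (C₂ * BD₁)))) * ‖A‖ := by
  have hCH' : 0 ≤ (CHω + 2 * (CR * (Real.sqrt 2 * BD₁))) := by positivity
  refine h3_of_holderLetters_allMembers F h c₀ cB Δx hε₀ hε1 U₀ hreg ha hBD₁ hCR hC₁ hC₂ hCH' hD1 hR hc1 hc2 ?_ hsmall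
  intro A ct yt yt' h1 h2
  have hA : 0 ≤ ‖A‖ := norm_nonneg _
  -- H1's sup row `N_ω = (C_R·√2·B_{D1})·‖A‖` of `ω₁(A)` (internal — ✓`storeyH_value_rows`, first conjunct)
  have hN : ∀ y : TSite 3 (periodsT3 F K),
      ‖WL2.equiv ℂ (fun _ : TSite 3 (periodsT3 F K) => c₀) W₂ (RS F n K h c₀ cB U₀ (DstarL2 F n K c₀ U₀ (GT F n K h c₀ cB a Δx U₀ (toL2 F K c₀ A)))) y‖ ≤ (CR * (Real.sqrt 2 * BD₁)) * ‖A‖ :=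
    (storeyH_value_rows F h c₀ cB Δx U₀ hD1 hR hc1 hc2 A).1
  -- H2b v2: window removal on each cover ball (✓`hHωt_of_window`) — the windowed letter + the sup ⟹ H7-R's cover letter, constant `H_ω + 2N_ω`
  have key := hHωt_of_window F n K c₀ U₀ (RS F n K h c₀ cB U₀ (DstarL2 F n K c₀ U₀ (GT F n K h c₀ cB a Δx U₀ (toL2 F K c₀ A)))) (mul_nonneg (by positivity) hA) (mul_nonneg hCHω hA) hN (hHωw A) ct yt yt' h1 h2
  have hc : (CHω * ‖A‖ + 2 * ((CR * (Real.sqrt 2 * BD₁)) * ‖A‖)) = (CHω + 2 * (CR * (Real.sqrt 2 * BD₁))) * ‖A‖ := by ring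
  rw [hc] at key
  exact key

end Summit.QuantumFields.YangMills.Theorems.Prop7StoreyHGradientRowOfWindowedHolder

end
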